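import Literature.NumberTheory.EllipticCurves.ModPReducibilityProofs
import HarnessLib

/-!
# Reducibility of `E[p]` from Eisenstein congruences off a finite set of primes (proofs)

`Proofs` file (theorems only: no definition, no named fact, no instance) in topic
`NumberTheory/EllipticCurves`, sibling of `ModPReducibility` (statements) and `ModPReducibilityProofs`
(the discharge of `not_irreducible_of_frobeniusTrace_congr`, the instance `S = {p} ∪ {bad primes}`).
It discharges the finite-exceptional-set form
`Literature.NumberTheory.EllipticCurves.not_irreducible_of_frobeniusTrace_congr_off_finset`
(Darmon–Diamond–Taylor 1995, Prop. 2.6(b) with 2.8(a), 2.11(a): "a semi-simple mod `ℓ`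
representation … is determined by the values of `tr ∧^i ρ(Frob_p)` on the primes `p ∉ S` at which
`ρ` is unramified", for ANY finite `S`): if `a_ℓ(E) ≡ ℓ + 1 (mod p)` for every prime `ℓ` of good
reduction outside a finite set `S`, then `E[p]` is a reducible `Γ_ℚ`-module.

## The proof

Verbatim the argument of `not_irreducible_of_frobeniusTrace_congr_holds` (file
`ModPReducibilityProofs`), whose Frobenius density theorem
(`exists_frobenius_pow_smul_eq_geomTorsion`, division form) already excludes an ARBITRARY finite set
of primes — here `{p} ∪ {ℓ ∣ Δ_min(E)} ∪ S`: every `σ ∈ Γ_ℚ` acts on `E[p]` as a power of an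
arithmetic Frobenius `φ` above a good prime `ℓ ∉ S`, `ℓ ≠ p`; `p ∣ a_ℓ - ℓ - 1` means
`p ∣ #Ẽ(𝔽_ℓ)` (`dvd_frobeniusTrace_sub_iff`), so `φ` fixes a non-zero point of `E[p]` (reduction
of torsion, `exists_frobenius_smul_eq_of_dvd_reductionPointCount_holds`), hence so does `σ`; a
plane `𝔽_p`-representation all of whose elements have the eigenvalue `1` fixes a line
(`not_irreducible_of_forall_exists_smul_eq`).  Consumer: the «Eisenstein end» of the relative
Ihara lemma of route `ManinLocalTwoThree` (`Summits/…/Theorems/ManinLocalTwoThreeEisensteinEnd`,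
binder `hDDT`).

## Main result

* `Literature.NumberTheory.EllipticCurves.not_irreducible_of_frobeniusTrace_congr_off_finset_holds`.

## References

* [DarmonDiamondTaylor1995] H. Darmon, F. Diamond, R. Taylor, *Fermat's Last Theorem*, in
  *Current Developments in Mathematics 1995*, Prop. 2.6(b), 2.8(a), 2.11(a) (PDF pp. 53–57).
* [SilvermanAEC2009] J. H. Silverman, *The Arithmetic of Elliptic Curves*, 2nd ed., VII.3.1(b)
  (reduction of torsion), III.6.4(b).
-/

noncomputable section

open scoped Classical

namespace Literature.NumberTheory.EllipticCurves

open NumberField IsDedekindDomain Field WeierstrassCurve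

/-- **`E[p]` is reducible when the good Frobenius traces off a finite set are Eisenstein mod `p` —
discharge of the named fact `not_irreducible_of_frobeniusTrace_congr_off_finset`**
(Darmon–Diamond–Taylor 1995, Prop. 2.6(b) with 2.8(a), 2.11(a), for an ARBITRARY finite
exceptional set `S`).  Same argument as `not_irreducible_of_frobeniusTrace_congr_holds`: Frobenius'
density theorem in the tree (`exists_frobenius_pow_smul_eq_geomTorsion`) already excludes an
arbitrary finite set of primes, here `{p} ∪ {ℓ ∣ Δ_min} ∪ S`; every `σ ∈ Γ_ℚ` then acts on `E[p]` as
a power of an arithmetic Frobenius `φ` above a good `ℓ ∉ S`, `ℓ ≠ p`, which fixes a non-zero point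
of `E[p]` because `p ∣ #Ẽ(𝔽_ℓ)` (`dvd_frobeniusTrace_sub_iff`,
`exists_frobenius_smul_eq_of_dvd_reductionPointCount_holds`); conclude with
`not_irreducible_of_forall_exists_smul_eq`.
[cite: DarmonDiamondTaylor1995, Prop. 2.6(b), Prop. 2.8(a), Prop. 2.11(a) (PDF pp. 53–57)] -/
theorem not_irreducible_of_frobeniusTrace_congr_off_finset_holds :
    not_irreducible_of_frobeniusTrace_congr_off_finset := by
  intro W _ _ p _ S₀ hcongr
  classical
  have hp : p.Prime := Fact.out
  -- the excluded primes: `p`, the divisors of the minimal discriminant, and `S₀`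
  have hΔ0 : minimalDiscriminantInt W ≠ 0 := minimalDiscriminantInt_ne_zero W
  let S : Set ℕ := {ℓ | ℓ = p ∨ (ℓ : ℤ) ∣ minimalDiscriminantInt W ∨ ℓ ∈ S₀}
  have hS : S.Finite := by
    refine ((Set.finite_le_nat (max p (minimalDiscriminantInt W).natAbs)).union
      (S₀ : Set ℕ).toFinite).subset ?_
    rintro ℓ (rfl | hℓ | hℓ)
    · exact Or.inl (Set.mem_setOf.mpr (le_max_left _ _))
    · exact Or.inl (Set.mem_setOf.mpr (le_max_of_le_right
        (Nat.le_of_dvd (Int.natAbs_pos.mpr hΔ0) (Int.natCast_dvd.mp hℓ))))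
    · exact Or.inr hℓ
  -- every `σ ∈ Γ_ℚ` fixes a non-zero point of `E[p]`
  refine not_irreducible_of_forall_exists_smul_eq W p fun σ ↦ ?_
  obtain ⟨ℓ, v, 𝔓, φ, hℓ, hℓS, hv, h𝔓, hφ, j, hagree⟩ :=
    exists_frobenius_pow_smul_eq_geomTorsion W (n := p) (by exact_mod_cast hp.ne_zero) S hS σ
  haveI : Fact ℓ.Prime := ⟨hℓ⟩
  have hℓp : ℓ ≠ p := fun h ↦ hℓS (Or.inl h)
  have hℓΔ : ¬ (ℓ : ℤ) ∣ minimalDiscriminantInt W := fun h ↦ hℓS (Or.inr (Or.inl h))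
  have hℓS₀ : ℓ ∉ S₀ := fun h ↦ hℓS (Or.inr (Or.inr h))
  have hgood : W.HasGoodReductionAtPrime ℓ := hasGoodReductionAtPrime_of_not_dvd W ℓ hℓΔ
  have hdvd : p ∣ W.reductionPointCount ℓ :=
    (dvd_frobeniusTrace_sub_iff W p ℓ).mp (hcongr ℓ hℓS₀ hgood)
  obtain ⟨P, hP0, hP⟩ :=
    exists_frobenius_smul_eq_of_dvd_reductionPointCount_holds W p ℓ hℓp hgood hdvd v hv 𝔓 h𝔓 φ hφ
  -- `φ • P = P`, hence `φ ^ j • P = P`, i.e. `σ • P = P`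
  refine ⟨P, hP0, ?_⟩
  rw [hagree P]
  exact MulAction.mem_stabilizer_iff.mp
    (Subgroup.pow_mem (MulAction.stabilizer (absoluteGaloisGroup ℚ) P)
      (MulAction.mem_stabilizer_iff.mpr hP) j)

end Literature.NumberTheory.EllipticCurves

end
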